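import Summits.NavierStokesRegularity.NavierStokesRegularity.Theses.TerminalTrace
import Summits.NavierStokesRegularity.NavierStokesRegularity.Theorems.TerminalTraceTypeITraceScarL3StubLocalTypeIOfTypeIBlowup
import Summits.NavierStokesRegularity.NavierStokesRegularity.Theorems.TerminalTraceTypeITraceScarL3StubExtinctApexDOfL3Trace
import Summits.NavierStokesRegularity.NavierStokesRegularity.Theorems.TerminalTraceTypeITraceScarL3StubNoConfinedExtinctApex
import Literature.Analysis.FluidPDE.LocalTypeI
import HarnessLib

/-!
# Item `TerminalTrace.TypeITraceScarL3` (stmt-NavierStokesRegularity-18385): the QUIET-SHELL / LOUD-DUST cut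
# of line `annulus-dichotomy` (skeleton v3, sha16 a0af4d6cb8b072dd) as a tree theorem — Stub C follows BY NAME
# from the two shell statements, and so does the item

Seat ns-typeII-p3 g10 (cell ns-regularity-ideate), `--supports stmt-NavierStokesRegularity-18385` (helper; the
kernel record asked for as test T-26.5 of nsreg-p2 g28's ROUND-26).  Everything here is CONDITIONAL on its
displayed hypotheses; nothing closes the item, and neither shell statement is proved here.

The two shell statements of skeleton v3 (`R26-line-annulus-dichotomy.lean`), VERBATIM:
* QUIET-SHELL EXCLUSION (`stub_no_quietShellExtinctApex`, the hypothesis `hQA` below): for every class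
  `(M, D₀, C)` there is a ratio `A₀ > 1` such that an extinct Type-I apex — suitable in every `Q(a)`, weak
  gradient, `𝐈(Q(a)) ≤ M`, `D ≤ D₀` at every apex `t₀ ≤ 0`, rate `C/√(−s)`, weakly null at the top — which is
  essentially bounded on ONE shell slab `]−δ,0[ × {R < |y| < A₀R}` is not backward singular at the origin;
* LOUD-DUST EXCLUSION (`stub_no_loudShellExtinctApex`, the hypothesis `hLOUD` below): given a
  quiet-shell-excluding ratio `A₀ > 1` for the class, an extinct Type-I apex with NO quiet shell of ratio `A₀`
  is not backward singular at the origin.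

* `no_spreadExtinctApex_of_shellStubs` — Stub C `stub_no_spreadExtinctApex` of line `apex-dichotomy`
  VERBATIM from the two shell statements: fix `A₀` from `hQA`, split on the quiet-shell clause `QA(U, A₀)`;
  the SPREAD hypothesis is not even used (a confined apex is re-covered by quiet-shell exclusion).
* `typeITraceScarL3_of_shellStubs` — the item BY NAME from the two shell statements: the skeleton's
  composition `TypeITraceScarL3_of_stubs` with the `sorry`s of its three LANDED stubs replaced by the tree
  theorems `stub_localTypeI_of_typeIBlowup` (p576636), `stub_extinctApexD_of_L3trace` (p583907),
  `stub_no_confinedExtinctApex` (p585263) and Stub C by the previous theorem (same proof as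
  `typeITraceScarL3_of_no_spreadExtinctApex`, p585751, restated here so that this file imports no module
  that itself imports the route file).

WHAT THIS IS NOT: not NS regularity, not item 18385, not Stub QA / Stub LOUD — a by-name reduction; both
shell statements are OPEN (QA: closable per ROUND-26 §1c; LOUD: the residual hard core).
[folklore; Tao 2019 arXiv:1908.04958 §5; AlbrittonBarker2019 §3]
-/

noncomputable section

set_option linter.dupNamespace false

namespace Summit.NavierStokesRegularity.NavierStokesRegularity.Theorems.TypeITraceScarL3

open MeasureTheory Set Function Filter Topology Metric
open Literature.Analysis.FluidPDE
open scoped NNReal ENNReal InnerProductSpace RealInnerProductSpace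

/-- **Stub C from the two shell statements** (the cut of line `annulus-dichotomy`, kernel record).  IF
(quiet-shell exclusion) every class `(M, D₀, C)` has a ratio `A₀ > 1` such that an extinct Type-I apex
essentially bounded on one shell slab `]−δ,0[ × {R < |y| < A₀R}` is not backward singular at the origin,
AND (loud-dust exclusion) for such a ratio an extinct Type-I apex with no quiet shell of ratio `A₀` is not
backward singular at the origin either, THEN no SPREAD extinct Type-I apex is backward singular at the
origin (Stub C `stub_no_spreadExtinctApex` of line `apex-dichotomy`, verbatim).  Proof: obtain `A₀` from the
first hypothesis and decide whether `U` has a quiet shell of ratio `A₀`; the spread clause is unused.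
[folklore; Tao 2019 arXiv:1908.04958 §5 (the shell of regularity (5.10))] -/
theorem no_spreadExtinctApex_of_shellStubs
    (hQA : ∀ (M D₀ : ℝ≥0) (C : ℝ), ∃ A₀ : ℝ, 1 < A₀ ∧
      ∀ (U : ℝ → EuclideanSpace ℝ (Fin 3) → EuclideanSpace ℝ (Fin 3))
        (P : ℝ → EuclideanSpace ℝ (Fin 3) → ℝ)
        (G : ℝ → EuclideanSpace ℝ (Fin 3) →
          EuclideanSpace ℝ (Fin 3) →L[ℝ] EuclideanSpace ℝ (Fin 3)),
        (∀ a : ℝ, 0 < a →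
          IsSuitableWeakSolutionInBall a (0 : ℝ × EuclideanSpace ℝ (Fin 3)) U P) →
        (∀ a : ℝ, 0 < a →
          HasWeakSpatialGradientOn
            (parabolicCylinderOpens a (0 : ℝ × EuclideanSpace ℝ (Fin 3))) U G) →
        (∀ a : ℝ, 0 < a →
          typeIBound (parabolicCylinder a (0 : ℝ × EuclideanSpace ℝ (Fin 3))) U P G ≤ M) →
        (∀ z₀ : ℝ × EuclideanSpace ℝ (Fin 3), z₀.1 ≤ 0 →
          ∀ r : ℝ, 0 < r → cknD r z₀ P ≤ D₀) →
        (∀ s : ℝ, s < 0 →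
          ∀ᵐ y : EuclideanSpace ℝ (Fin 3), ‖U s y‖ ≤ C / Real.sqrt (-s)) →
        (∀ φ : EuclideanSpace ℝ (Fin 3) → EuclideanSpace ℝ (Fin 3),
          ContDiff ℝ (⊤ : ℕ∞) φ →
          HasCompactSupport φ → ∀ ε : ℝ, 0 < ε →
          ∃ s₀ : ℝ, s₀ < 0 ∧ ∀ᵐ s ∂(volume.restrict (Ioo s₀ 0)), |∫ y, ⟪U s y, φ y⟫| ≤ ε) →
        (∃ δ : ℝ, 0 < δ ∧ ∃ R : ℝ, 0 < R ∧ ∃ K : ℝ,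
          ∀ᵐ z ∂(volume.restrict
            (Ioo (-δ) 0 ×ˢ {y : EuclideanSpace ℝ (Fin 3) | R < ‖y‖ ∧ ‖y‖ < A₀ * R})),
              ‖U z.1 z.2‖ ≤ K) →
        ¬ IsBackwardSingularPoint U (0 : ℝ × EuclideanSpace ℝ (Fin 3)))
    (hLOUD : ∀ (M D₀ : ℝ≥0) (C A₀ : ℝ), 1 < A₀ →
      (∀ (U : ℝ → EuclideanSpace ℝ (Fin 3) → EuclideanSpace ℝ (Fin 3))
        (P : ℝ → EuclideanSpace ℝ (Fin 3) → ℝ)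
        (G : ℝ → EuclideanSpace ℝ (Fin 3) →
          EuclideanSpace ℝ (Fin 3) →L[ℝ] EuclideanSpace ℝ (Fin 3)),
        (∀ a : ℝ, 0 < a →
          IsSuitableWeakSolutionInBall a (0 : ℝ × EuclideanSpace ℝ (Fin 3)) U P) →
        (∀ a : ℝ, 0 < a →
          HasWeakSpatialGradientOn
            (parabolicCylinderOpens a (0 : ℝ × EuclideanSpace ℝ (Fin 3))) U G) →
        (∀ a : ℝ, 0 < a →
          typeIBound (parabolicCylinder a (0 : ℝ × EuclideanSpace ℝ (Fin 3))) U P G ≤ M) →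
        (∀ z₀ : ℝ × EuclideanSpace ℝ (Fin 3), z₀.1 ≤ 0 →
          ∀ r : ℝ, 0 < r → cknD r z₀ P ≤ D₀) →
        (∀ s : ℝ, s < 0 →
          ∀ᵐ y : EuclideanSpace ℝ (Fin 3), ‖U s y‖ ≤ C / Real.sqrt (-s)) →
        (∀ φ : EuclideanSpace ℝ (Fin 3) → EuclideanSpace ℝ (Fin 3),
          ContDiff ℝ (⊤ : ℕ∞) φ →
          HasCompactSupport φ → ∀ ε : ℝ, 0 < ε →
          ∃ s₀ : ℝ, s₀ < 0 ∧ ∀ᵐ s ∂(volume.restrict (Ioo s₀ 0)), |∫ y, ⟪U s y, φ y⟫| ≤ ε) →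
        (∃ δ : ℝ, 0 < δ ∧ ∃ R : ℝ, 0 < R ∧ ∃ K : ℝ,
          ∀ᵐ z ∂(volume.restrict
            (Ioo (-δ) 0 ×ˢ {y : EuclideanSpace ℝ (Fin 3) | R < ‖y‖ ∧ ‖y‖ < A₀ * R})),
              ‖U z.1 z.2‖ ≤ K) →
        ¬ IsBackwardSingularPoint U (0 : ℝ × EuclideanSpace ℝ (Fin 3))) →
      ∀ (U : ℝ → EuclideanSpace ℝ (Fin 3) → EuclideanSpace ℝ (Fin 3))
        (P : ℝ → EuclideanSpace ℝ (Fin 3) → ℝ)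
        (G : ℝ → EuclideanSpace ℝ (Fin 3) →
          EuclideanSpace ℝ (Fin 3) →L[ℝ] EuclideanSpace ℝ (Fin 3)),
        (∀ a : ℝ, 0 < a →
          IsSuitableWeakSolutionInBall a (0 : ℝ × EuclideanSpace ℝ (Fin 3)) U P) →
        (∀ a : ℝ, 0 < a →
          HasWeakSpatialGradientOn
            (parabolicCylinderOpens a (0 : ℝ × EuclideanSpace ℝ (Fin 3))) U G) →
        (∀ a : ℝ, 0 < a →
          typeIBound (parabolicCylinder a (0 : ℝ × EuclideanSpace ℝ (Fin 3))) U P G ≤ M) →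
        (∀ z₀ : ℝ × EuclideanSpace ℝ (Fin 3), z₀.1 ≤ 0 →
          ∀ r : ℝ, 0 < r → cknD r z₀ P ≤ D₀) →
        (∀ s : ℝ, s < 0 →
          ∀ᵐ y : EuclideanSpace ℝ (Fin 3), ‖U s y‖ ≤ C / Real.sqrt (-s)) →
        (∀ φ : EuclideanSpace ℝ (Fin 3) → EuclideanSpace ℝ (Fin 3),
          ContDiff ℝ (⊤ : ℕ∞) φ →
          HasCompactSupport φ → ∀ ε : ℝ, 0 < ε →
          ∃ s₀ : ℝ, s₀ < 0 ∧ ∀ᵐ s ∂(volume.restrict (Ioo s₀ 0)), |∫ y, ⟪U s y, φ y⟫| ≤ ε) →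
        (¬ ∃ δ : ℝ, 0 < δ ∧ ∃ R : ℝ, 0 < R ∧ ∃ K : ℝ,
          ∀ᵐ z ∂(volume.restrict
            (Ioo (-δ) 0 ×ˢ {y : EuclideanSpace ℝ (Fin 3) | R < ‖y‖ ∧ ‖y‖ < A₀ * R})),
              ‖U z.1 z.2‖ ≤ K) →
        ¬ IsBackwardSingularPoint U (0 : ℝ × EuclideanSpace ℝ (Fin 3))) :
    ∀ (U : ℝ → EuclideanSpace ℝ (Fin 3) → EuclideanSpace ℝ (Fin 3))
      (P : ℝ → EuclideanSpace ℝ (Fin 3) → ℝ)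
      (G : ℝ → EuclideanSpace ℝ (Fin 3) →
        EuclideanSpace ℝ (Fin 3) →L[ℝ] EuclideanSpace ℝ (Fin 3))
      (M D₀ : ℝ≥0) (C : ℝ),
      (∀ a : ℝ, 0 < a →
        IsSuitableWeakSolutionInBall a (0 : ℝ × EuclideanSpace ℝ (Fin 3)) U P) →
      (∀ a : ℝ, 0 < a →
        HasWeakSpatialGradientOn
          (parabolicCylinderOpens a (0 : ℝ × EuclideanSpace ℝ (Fin 3))) U G) →
      (∀ a : ℝ, 0 < a →
        typeIBound (parabolicCylinder a (0 : ℝ × EuclideanSpace ℝ (Fin 3))) U P G ≤ M) →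
      (∀ z₀ : ℝ × EuclideanSpace ℝ (Fin 3), z₀.1 ≤ 0 →
        ∀ r : ℝ, 0 < r → cknD r z₀ P ≤ D₀) →
      (∀ s : ℝ, s < 0 →
        ∀ᵐ y : EuclideanSpace ℝ (Fin 3), ‖U s y‖ ≤ C / Real.sqrt (-s)) →
      (∀ φ : EuclideanSpace ℝ (Fin 3) → EuclideanSpace ℝ (Fin 3),
        ContDiff ℝ (⊤ : ℕ∞) φ →
        HasCompactSupport φ → ∀ ε : ℝ, 0 < ε →
        ∃ s₀ : ℝ, s₀ < 0 ∧ ∀ᵐ s ∂(volume.restrict (Ioo s₀ 0)), |∫ y, ⟪U s y, φ y⟫| ≤ ε) →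
      (∀ δ : ℝ, 0 < δ → ∀ R K : ℝ,
        ¬ (∀ᵐ z ∂(volume.restrict
          (Ioo (-δ) 0 ×ˢ (closedBall (0 : EuclideanSpace ℝ (Fin 3)) R)ᶜ)), ‖U z.1 z.2‖ ≤ K)) →
      ¬ IsBackwardSingularPoint U (0 : ℝ × EuclideanSpace ℝ (Fin 3)) := by
  intro U P G M D₀ C hsw hG hI hD hrate htop _hspread
  obtain ⟨A₀, hA₀, hQA₀⟩ := hQA M D₀ C
  by_cases hquiet : ∃ δ : ℝ, 0 < δ ∧ ∃ R : ℝ, 0 < R ∧ ∃ K : ℝ,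
      ∀ᵐ z ∂(volume.restrict
        (Ioo (-δ) 0 ×ˢ {y : EuclideanSpace ℝ (Fin 3) | R < ‖y‖ ∧ ‖y‖ < A₀ * R})),
          ‖U z.1 z.2‖ ≤ K
  · exact hQA₀ U P G hsw hG hI hD hrate htop hquiet
  · exact hLOUD M D₀ C A₀ hA₀ hQA₀ U P G hsw hG hI hD hrate htop hquiet

/-- **`TypeITraceScarL3` from the two shell statements** (line `annulus-dichotomy` BY NAME, kernel record):
quiet-shell exclusion and loud-dust exclusion (the statements of the two open stubs
`stub_no_quietShellExtinctApex`, `stub_no_loudShellExtinctApex` of skeleton v3, verbatim) together imply the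
item `TerminalTrace.TypeITraceScarL3`.  Proof = the registered composition: an `L³` ball at a
backward-singular vertex of a Type-I-in-time first singularity produces a backward-singular extinct apex
with all six clauses (`stub_extinctApexD_of_L3trace` over `stub_localTypeI_of_typeIBlowup`); a CONFINED one
is excluded by `stub_no_confinedExtinctApex`, a SPREAD one by `no_spreadExtinctApex_of_shellStubs`.
[folklore; Tao 2019 arXiv:1908.04958 §5; Seregin2014 §6.6; AlbrittonBarker2019 §3] -/
theorem typeITraceScarL3_of_shellStubs
    (hQA : ∀ (M D₀ : ℝ≥0) (C : ℝ), ∃ A₀ : ℝ, 1 < A₀ ∧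
      ∀ (U : ℝ → EuclideanSpace ℝ (Fin 3) → EuclideanSpace ℝ (Fin 3))
        (P : ℝ → EuclideanSpace ℝ (Fin 3) → ℝ)
        (G : ℝ → EuclideanSpace ℝ (Fin 3) →
          EuclideanSpace ℝ (Fin 3) →L[ℝ] EuclideanSpace ℝ (Fin 3)),
        (∀ a : ℝ, 0 < a →
          IsSuitableWeakSolutionInBall a (0 : ℝ × EuclideanSpace ℝ (Fin 3)) U P) →
        (∀ a : ℝ, 0 < a →
          HasWeakSpatialGradientOn
            (parabolicCylinderOpens a (0 : ℝ × EuclideanSpace ℝ (Fin 3))) U G) →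
        (∀ a : ℝ, 0 < a →
          typeIBound (parabolicCylinder a (0 : ℝ × EuclideanSpace ℝ (Fin 3))) U P G ≤ M) →
        (∀ z₀ : ℝ × EuclideanSpace ℝ (Fin 3), z₀.1 ≤ 0 →
          ∀ r : ℝ, 0 < r → cknD r z₀ P ≤ D₀) →
        (∀ s : ℝ, s < 0 →
          ∀ᵐ y : EuclideanSpace ℝ (Fin 3), ‖U s y‖ ≤ C / Real.sqrt (-s)) →
        (∀ φ : EuclideanSpace ℝ (Fin 3) → EuclideanSpace ℝ (Fin 3),
          ContDiff ℝ (⊤ : ℕ∞) φ →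
          HasCompactSupport φ → ∀ ε : ℝ, 0 < ε →
          ∃ s₀ : ℝ, s₀ < 0 ∧ ∀ᵐ s ∂(volume.restrict (Ioo s₀ 0)), |∫ y, ⟪U s y, φ y⟫| ≤ ε) →
        (∃ δ : ℝ, 0 < δ ∧ ∃ R : ℝ, 0 < R ∧ ∃ K : ℝ,
          ∀ᵐ z ∂(volume.restrict
            (Ioo (-δ) 0 ×ˢ {y : EuclideanSpace ℝ (Fin 3) | R < ‖y‖ ∧ ‖y‖ < A₀ * R})),
              ‖U z.1 z.2‖ ≤ K) →
        ¬ IsBackwardSingularPoint U (0 : ℝ × EuclideanSpace ℝ (Fin 3)))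
    (hLOUD : ∀ (M D₀ : ℝ≥0) (C A₀ : ℝ), 1 < A₀ →
      (∀ (U : ℝ → EuclideanSpace ℝ (Fin 3) → EuclideanSpace ℝ (Fin 3))
        (P : ℝ → EuclideanSpace ℝ (Fin 3) → ℝ)
        (G : ℝ → EuclideanSpace ℝ (Fin 3) →
          EuclideanSpace ℝ (Fin 3) →L[ℝ] EuclideanSpace ℝ (Fin 3)),
        (∀ a : ℝ, 0 < a →
          IsSuitableWeakSolutionInBall a (0 : ℝ × EuclideanSpace ℝ (Fin 3)) U P) →
        (∀ a : ℝ, 0 < a →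
          HasWeakSpatialGradientOn
            (parabolicCylinderOpens a (0 : ℝ × EuclideanSpace ℝ (Fin 3))) U G) →
        (∀ a : ℝ, 0 < a →
          typeIBound (parabolicCylinder a (0 : ℝ × EuclideanSpace ℝ (Fin 3))) U P G ≤ M) →
        (∀ z₀ : ℝ × EuclideanSpace ℝ (Fin 3), z₀.1 ≤ 0 →
          ∀ r : ℝ, 0 < r → cknD r z₀ P ≤ D₀) →
        (∀ s : ℝ, s < 0 →
          ∀ᵐ y : EuclideanSpace ℝ (Fin 3), ‖U s y‖ ≤ C / Real.sqrt (-s)) →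
        (∀ φ : EuclideanSpace ℝ (Fin 3) → EuclideanSpace ℝ (Fin 3),
          ContDiff ℝ (⊤ : ℕ∞) φ →
          HasCompactSupport φ → ∀ ε : ℝ, 0 < ε →
          ∃ s₀ : ℝ, s₀ < 0 ∧ ∀ᵐ s ∂(volume.restrict (Ioo s₀ 0)), |∫ y, ⟪U s y, φ y⟫| ≤ ε) →
        (∃ δ : ℝ, 0 < δ ∧ ∃ R : ℝ, 0 < R ∧ ∃ K : ℝ,
          ∀ᵐ z ∂(volume.restrict
            (Ioo (-δ) 0 ×ˢ {y : EuclideanSpace ℝ (Fin 3) | R < ‖y‖ ∧ ‖y‖ < A₀ * R})),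
              ‖U z.1 z.2‖ ≤ K) →
        ¬ IsBackwardSingularPoint U (0 : ℝ × EuclideanSpace ℝ (Fin 3))) →
      ∀ (U : ℝ → EuclideanSpace ℝ (Fin 3) → EuclideanSpace ℝ (Fin 3))
        (P : ℝ → EuclideanSpace ℝ (Fin 3) → ℝ)
        (G : ℝ → EuclideanSpace ℝ (Fin 3) →
          EuclideanSpace ℝ (Fin 3) →L[ℝ] EuclideanSpace ℝ (Fin 3)),
        (∀ a : ℝ, 0 < a →
          IsSuitableWeakSolutionInBall a (0 : ℝ × EuclideanSpace ℝ (Fin 3)) U P) →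
        (∀ a : ℝ, 0 < a →
          HasWeakSpatialGradientOn
            (parabolicCylinderOpens a (0 : ℝ × EuclideanSpace ℝ (Fin 3))) U G) →
        (∀ a : ℝ, 0 < a →
          typeIBound (parabolicCylinder a (0 : ℝ × EuclideanSpace ℝ (Fin 3))) U P G ≤ M) →
        (∀ z₀ : ℝ × EuclideanSpace ℝ (Fin 3), z₀.1 ≤ 0 →
          ∀ r : ℝ, 0 < r → cknD r z₀ P ≤ D₀) →
        (∀ s : ℝ, s < 0 →
          ∀ᵐ y : EuclideanSpace ℝ (Fin 3), ‖U s y‖ ≤ C / Real.sqrt (-s)) →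
        (∀ φ : EuclideanSpace ℝ (Fin 3) → EuclideanSpace ℝ (Fin 3),
          ContDiff ℝ (⊤ : ℕ∞) φ →
          HasCompactSupport φ → ∀ ε : ℝ, 0 < ε →
          ∃ s₀ : ℝ, s₀ < 0 ∧ ∀ᵐ s ∂(volume.restrict (Ioo s₀ 0)), |∫ y, ⟪U s y, φ y⟫| ≤ ε) →
        (¬ ∃ δ : ℝ, 0 < δ ∧ ∃ R : ℝ, 0 < R ∧ ∃ K : ℝ,
          ∀ᵐ z ∂(volume.restrict
            (Ioo (-δ) 0 ×ˢ {y : EuclideanSpace ℝ (Fin 3) | R < ‖y‖ ∧ ‖y‖ < A₀ * R})),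
              ‖U z.1 z.2‖ ≤ K) →
        ¬ IsBackwardSingularPoint U (0 : ℝ × EuclideanSpace ℝ (Fin 3))) :
    Summit.NavierStokesRegularity.NavierStokesRegularity.Theses.TerminalTrace.TypeITraceScarL3 := by
  intro ν T hν hT u p hcl hLH _hdec hTI x₀ hsing ρ hρ hmem
  obtain ⟨U, P, G, M, D₀, C, hsw, hG, hI, hD, hrate, htop, hsingU⟩ :=
    stub_extinctApexD_of_L3trace ν T hν hT u p hcl hLH hTI x₀
      (TerminalTraceTypeITraceScarL3StubLocalTypeIOfTypeIBlowup.stub_localTypeI_of_typeIBlowup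
        ν T hν hT u p hcl hLH hTI x₀)
      hsing ⟨ρ, hρ, hmem⟩
  by_cases hfar : ∃ δ : ℝ, 0 < δ ∧ ∃ R K : ℝ,
      ∀ᵐ z ∂(volume.restrict
        (Ioo (-δ) 0 ×ˢ (closedBall (0 : EuclideanSpace ℝ (Fin 3)) R)ᶜ)), ‖U z.1 z.2‖ ≤ K
  · exact stub_no_confinedExtinctApex U P G M D₀ C hsw hG hI hD hrate htop hfar hsingU
  · exact no_spreadExtinctApex_of_shellStubs hQA hLOUD U P G M D₀ C hsw hG hI hD hrate htop
      (fun δ hδ R K hbound => hfar ⟨δ, hδ, R, K, hbound⟩) hsingU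

end Summit.NavierStokesRegularity.NavierStokesRegularity.Theorems.TypeITraceScarL3

end
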